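import Literature.NumberTheory.EllipticCurves.ZpExtensionEisensteinSelmerStructureProofs
import HarnessLib

/-!
# Membership in Howard's `H¹_{F_𝔮}(K, T_𝔮)`: the place-by-place criterion on local families
# (theorems only; no definition, no named fact, no instance)

Topic `NumberTheory/EllipticCurves` (D1 road of cell `pub/bsd-print-x9`; companion of
`ZpExtensionEisensteinSelmerStructure[Proofs]`). For an element `h` of the pinned `H¹(K, T_𝔮)`
(`D : ZpExtension.EisensteinH1Data κ ρ t hm`) its LOCAL FAMILY at a place `v` is
`k ↦ loc_v (D.proj k h) ∈ H¹(K_v, W_k)`; it is automatically a compatible family of the local tower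
(`localization_proj_mem_compatibleFamilies`). This file records the criterion by which the Selmer
compatibility of Howard's control map `𝔖 = H¹_{F_Λ}(K, 𝐓) → H¹(K, T_𝔮)` [Howard 2004, Lemma 3.2.7 /
Prop. 3.2.8 (arXiv)] is to be proved place by place, i.e. the exact local statements the arithmetic has
to supply:

* `EisensteinH1Data.mem_ordinarySelmer_of_local` — `h ∈ H¹_{F_𝔮}(K, T_𝔮)` as soon as
  (p) at every `v ∣ p` some FIXED power `p^a` (independent of `k`) pushes the local family into the strict
      ordinary cores `ker (H¹(K_v, W_k) → H¹(K_v, W_k / A_{m,k} ⊗ Fil_v M_k))`;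
  (S) at every `v ∈ S`, `v ∤ p` some fixed power `p^a` pushes it into the unramified subgroups;
  (ur) at every other finite place every member of the family is unramified.
  (Nothing at the infinite places.) — by the saturation/level-condition dictionary of
  `ZpExtensionEisensteinSelmerStructure` (`Tower.apply_mem_levelCondition`).
* `EisensteinH1Data.mem_ordinarySelmer_of_local_of_torsion` — the same with (S) replaced by the stronger
  but commoner «`p^a` kills the local family at `v`» (torsion local classes are saturated-anything).
* the converse unfoldings `localization_proj_mem_unramifiedSubgroup_of_mem_ordinarySelmer` (at `v ∉ S ∪ {v ∣ p}`
  a Selmer element is unramified at every level) and `exists_nsmul_mem_ordinaryCore_of_mem_ordinarySelmer`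
  (at `v ∣ p` every level of a Selmer element is a component of a saturated family for the ordinary cores).

For the intended instance (`M_k = E[p^k]`, `𝔖` the compact Selmer module of `E` along the anticyclotomic
tower, `h = f(s)` the image of `s ∈ 𝔖` under the control map of `ZpExtensionEisensteinTwistCores`) the three
inputs are: (ur) Kummer classes at places of good reduction away from `p` are unramified (Néron–Ogg–Shafarevich)
and corestriction preserves this; (S) at a bad place `w ∤ p` the restriction to inertia of a Kummer class is
killed by the `p`-part of the Tamagawa number (component group), uniformly along the unramified tower
`K_{∞,w}/K_v`; (p) at `v ∣ p` (good ordinary) a Kummer class maps in `H¹(K_w, Ẽ[p^k] ⊗ ·)` to a class killed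
by `#Ẽ(k_w)[p^∞]` (reduction), uniformly since the residue extension of `K_{∞,w}/K_v` is finite — together
with the double coset formula for `res_{D_v} ∘ cor` (tree `ContinuousCorestrictionDoubleCoset`). None of these
is proved here. BSD is not proved by any of this.

References: [Howard2004HeegnerKolyvagin] B. Howard, Compositio Math. 140 (2004) — arXiv 1202.6340 Def. 2.1.1,
Def. 3.1.2, Lemma 3.2.7, Prop. 3.2.8; [GreenbergLNM1716] R. Greenberg, LNM 1716 (1999), §2 (Prop. 2.2–2.4: local
Kummer conditions vs. Greenberg conditions); [MazurRubinMemoirs2004] Lemma 5.3.13, Prop. 5.3.14.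
-/

noncomputable section

open scoped TensorProduct Topology ContRepresentation
open Field Filter IsDedekindDomain

universe u

namespace Literature.NumberTheory.EllipticCurves

open Literature.NumberTheory.GaloisRepresentations
open Literature.NumberTheory.GaloisRepresentations.DiscreteGaloisModule (SelmerStructure)
open scoped NumberField

namespace ZpExtension

namespace EisensteinH1Data

variable {K : Type u} [Field K] [NumberField K] {p : ℕ} [hp : Fact p.Prime] {κ : ZpExtension K p}
  {M : ℕ → Type u} [∀ k, AddCommGroup (M k)] [∀ k, TopologicalSpace (M k)] [∀ k, DiscreteTopology (M k)]
  {ρ : ∀ k, DiscreteGaloisModule K (M k)}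
  {t : ∀ k, (ρ (k + 1)).toContRepresentation →ⁱL (ρ k).toContRepresentation} {m : ℕ} {hm : 1 ≤ m}
  (D : EisensteinH1Data κ ρ t hm) (S : Finset (HeightOneSpectrum (𝓞 K)))
  (Φ : ∀ v : HeightOneSpectrum (𝓞 K), ((p : ℕ) : 𝓞 K) ∈ v.asIdeal → OrdinaryFiltration ρ t v)

/-- **The place-by-place criterion for `h ∈ H¹_{F_𝔮}(K, T_𝔮)`.** Let `h` be an element of the pinned
`H¹(K, T_𝔮)` with local families `k ↦ loc_v (proj k h)`. If
(p) at every `v ∣ p` there is `a` with `p^a • loc_v (proj k h)` in the strict ordinary core for all `k`;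
(S) at every `v ∈ S`, `v ∤ p` there is `a` with `p^a • loc_v (proj k h)` unramified for all `k`;
(ur) at every finite `v ∉ S`, `v ∤ p`, `loc_v (proj k h)` is unramified for all `k` —
then `h ∈ H¹_{F_𝔮}(K, T_𝔮)` (`ordinarySelmer`). The local families are compatible automatically, so (p) and
(S) say exactly that they are SATURATED families for the respective cores, whose components lie in the level
conditions by definition. [cite: Howard2004HeegnerKolyvagin, Def. 2.1.1 (propagation) and Def. 3.1.2, Lemma 3.2.7 (the local comparison)]
[cite: MazurRubinMemoirs2004, Lemma 5.3.13] -/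
theorem mem_ordinarySelmer_of_local (h : D.H)
    (hordp : ∀ (v : HeightOneSpectrum (𝓞 K)) (hv : ((p : ℕ) : 𝓞 K) ∈ v.asIdeal), ∃ a : ℕ, ∀ k,
      p ^ a • galoisCohomology.localization (κ.eisensteinTwist (ρ k) hm k) (Sum.inr v) 1 (D.proj k h) ∈
        (Φ v hv).ordinaryCore hm k)
    (hS : ∀ v ∈ S, ((p : ℕ) : 𝓞 K) ∉ v.asIdeal → ∃ a : ℕ, ∀ k,
      p ^ a • galoisCohomology.localization (κ.eisensteinTwist (ρ k) hm k) (Sum.inr v) 1 (D.proj k h) ∈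
        DiscreteGaloisModule.unramifiedSubgroup (GaloisRep.toLocal v (κ.eisensteinTwist (ρ k) hm k)) 1)
    (hur : ∀ v ∉ S, ((p : ℕ) : 𝓞 K) ∉ v.asIdeal → ∀ k,
      galoisCohomology.localization (κ.eisensteinTwist (ρ k) hm k) (Sum.inr v) 1 (D.proj k h) ∈
        DiscreteGaloisModule.unramifiedSubgroup (GaloisRep.toLocal v (κ.eisensteinTwist (ρ k) hm k)) 1) :
    h ∈ D.ordinarySelmer S Φ := by
  classical
  rw [mem_ordinarySelmer_iff_forall]
  intro k v
  rcases v with w | v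
  · rw [eisensteinSelmerStructure_inl]
    exact AddSubgroup.mem_top _
  · have hcompat := κ.localization_proj_mem_compatibleFamilies ρ t hm D (Sum.inr v) h
    rw [Tower.mem_compatibleFamilies_iff] at hcompat
    by_cases hv : ((p : ℕ) : 𝓞 K) ∈ v.asIdeal
    · rw [κ.eisensteinSelmerStructure_inr_of_mem ρ t hm S Φ k hv]
      obtain ⟨a, ha⟩ := hordp v hv
      exact Tower.apply_mem_levelCondition _ p _
        ((Tower.mem_saturatedFamilies_iff _ p _ _).2 ⟨hcompat, a, ha⟩) k
    · by_cases hvS : v ∈ S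
      · rw [κ.eisensteinSelmerStructure_inr_of_mem_of_not_mem ρ t hm S Φ k hv hvS]
        obtain ⟨a, ha⟩ := hS v hvS hv
        exact Tower.apply_mem_levelCondition _ p _
          ((Tower.mem_saturatedFamilies_iff _ p _ _).2 ⟨hcompat, a, ha⟩) k
      · rw [κ.eisensteinSelmerStructure_inr_of_not_mem ρ t hm S Φ k hv hvS]
        exact hur v hvS hv k

/-- **The same with (S) in torsion form**: at the bad places away from `p` it suffices that a fixed power
`p^a` KILLS the local family (`p^a • loc_v (proj k h) = 0` for all `k`) — torsion local classes are
saturated for any core. (For `𝔖`: local Kummer classes at `w ∤ p` are torsion; what has to be uniform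
along the tower is the exponent on INERTIA, cf. the module docstring.)
[cite: Howard2004HeegnerKolyvagin, Def. 2.1.1 and Lemma 3.2.7] [cite: MazurRubinMemoirs2004, Lemma 5.3.13] -/
theorem mem_ordinarySelmer_of_local_of_torsion (h : D.H)
    (hordp : ∀ (v : HeightOneSpectrum (𝓞 K)) (hv : ((p : ℕ) : 𝓞 K) ∈ v.asIdeal), ∃ a : ℕ, ∀ k,
      p ^ a • galoisCohomology.localization (κ.eisensteinTwist (ρ k) hm k) (Sum.inr v) 1 (D.proj k h) ∈
        (Φ v hv).ordinaryCore hm k)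
    (hS : ∀ v ∈ S, ((p : ℕ) : 𝓞 K) ∉ v.asIdeal → ∃ a : ℕ, ∀ k,
      p ^ a • galoisCohomology.localization (κ.eisensteinTwist (ρ k) hm k) (Sum.inr v) 1 (D.proj k h) = 0)
    (hur : ∀ v ∉ S, ((p : ℕ) : 𝓞 K) ∉ v.asIdeal → ∀ k,
      galoisCohomology.localization (κ.eisensteinTwist (ρ k) hm k) (Sum.inr v) 1 (D.proj k h) ∈
        DiscreteGaloisModule.unramifiedSubgroup (GaloisRep.toLocal v (κ.eisensteinTwist (ρ k) hm k)) 1) :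
    h ∈ D.ordinarySelmer S Φ :=
  D.mem_ordinarySelmer_of_local S Φ h hordp
    (fun v hvS hv ↦ by
      obtain ⟨a, ha⟩ := hS v hvS hv
      exact ⟨a, fun k ↦ by rw [ha k]; exact zero_mem _⟩)
    hur

/-- **Conversely, at a finite place outside `S ∪ {v ∣ p}` a Selmer element is unramified at every level.**
[cite: Howard2004HeegnerKolyvagin, Def. 2.1.10 (H¹_F = H¹_unr outside Σ(F))] -/
theorem localization_proj_mem_unramifiedSubgroup_of_mem_ordinarySelmer {h : D.H}
    (hh : h ∈ D.ordinarySelmer S Φ) {v : HeightOneSpectrum (𝓞 K)} (hvS : v ∉ S)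
    (hv : ((p : ℕ) : 𝓞 K) ∉ v.asIdeal) (k : ℕ) :
    galoisCohomology.localization (κ.eisensteinTwist (ρ k) hm k) (Sum.inr v) 1 (D.proj k h) ∈
      DiscreteGaloisModule.unramifiedSubgroup (GaloisRep.toLocal v (κ.eisensteinTwist (ρ k) hm k)) 1 := by
  have h' := (D.mem_ordinarySelmer_iff_forall S Φ h).1 hh k (Sum.inr v)
  rwa [κ.eisensteinSelmerStructure_inr_of_not_mem ρ t hm S Φ k hv hvS] at h'

/-- **Conversely, at `v ∣ p` every level of a Selmer element is the `k`-th component of a saturated family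
for the strict ordinary cores** (the unfolding of the definition: a reduction-compatible local family `x`,
pushed into the cores by a fixed `p^a`, with `x k = loc_v (proj k h)`; the witness may depend on `k`).
[cite: Howard2004HeegnerKolyvagin, Def. 2.1.1 and Def. 3.1.2] -/
theorem exists_nsmul_mem_ordinaryCore_of_mem_ordinarySelmer {h : D.H} (hh : h ∈ D.ordinarySelmer S Φ)
    {v : HeightOneSpectrum (𝓞 K)} (hv : ((p : ℕ) : 𝓞 K) ∈ v.asIdeal) (k : ℕ) :
    ∃ (x : Π j, galoisCohomology ((κ.eisensteinTwist (ρ j) hm j).toLocal (Sum.inr v)) 1) (a : ℕ),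
      (∀ j, κ.eisensteinLocalReduce ρ t hm (Sum.inr v) j (x (j + 1)) = x j) ∧
      (∀ j, p ^ a • x j ∈ (Φ v hv).ordinaryCore hm j) ∧
      x k = galoisCohomology.localization (κ.eisensteinTwist (ρ k) hm k) (Sum.inr v) 1 (D.proj k h) := by
  have h' := (D.mem_ordinarySelmer_iff_forall S Φ h).1 hh k (Sum.inr v)
  rw [κ.eisensteinSelmerStructure_inr_of_mem ρ t hm S Φ k hv, Tower.mem_levelCondition_iff] at h'
  obtain ⟨x, hx, hxk⟩ := h'
  rw [Tower.mem_saturatedFamilies_iff] at hx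
  obtain ⟨hxc, a, ha⟩ := hx
  exact ⟨x, a, hxc, ha, hxk⟩

end EisensteinH1Data

end ZpExtension

end Literature.NumberTheory.EllipticCurves

end
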